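import Summits.QuantumFields.YangMills.Theorems.DiagonalMirrorRPRSignTwistedCore
import Summits.QuantumFields.YangMills.Theorems.PencilRigidityWeakCouplingHypercubicLimitRPDiagRPOfSwapPairing

/-!
# Crux `WeakCouplingHypercubicLimitRP` (stmt-QuantumFields-27398), line `Sketch`, stub D1 `stub_diagRPOfPlaneLimits`:
# the DOOR-B COMPOSITION under `Theorems/` — D1 ⟸ the model letters `TwistLetters` on the witness (sub-)scheme

Helper file (`--supports stmt-QuantumFields-27398 --as helper`) of the hand `hand-10604-wilsonDiagModel-2` (docket director-ym g23, O4 WORD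
18 (3)(ii) / 20: door-B suppliers along `φ`) for the registered stub D1 `stub_diagRPOfPlaneLimits` of
`Cruxes/WeakCouplingHypercubicLimitRP/Lines/Sketch.lean` (sha16 `7bf38c709623ad77`); it closes nothing by itself.

WHAT (all by name, no body restated).  The door-B chain is now kernel-checked end to end below the two MODEL letters:
* `oddTorusSwapPairingLiminf_subseq_of_twistLetters`: `TwistLetters r (subseq sch φ hφ)` (R1 `OddTwistGap` + R2 `DiagLukewarm` on SOME two-sector
  model of the sub-scheme) + D1's own binders `PolyRenorm r sch`, `UniformFunctionalBoundPlanes r sch`, `PolyVolume sch` ⇒ the socket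
  `OddTorusSwapPairingLiminf r (subseq sch φ hφ)` — `core_of` (`…Theorems.DiagonalMirrorRPRSignTwistedCore`) run at the sub-scheme with the scheme
  letter `Growth r (subseq sch φ hφ)` DISCHARGED from D1's binders (`growth_subseq_of_polyRenorm_of_ufbPlanes`, κ3: `PolyRenorm ∧ UFB ⇒` renormalised
  counterterm bound; `PolyVolume ⇒ SideGrowth`); the variant `…_of_twistLetters_scheme` takes the letters on the SCHEME and restricts them
  (`TwistLetters.subseq`, i.e. `DiagonalSliceModel.restrict φ`);
* **`diagRPOfPlaneLimits_of_twistLetters`**: D1's conclusion `DiagonalFrameRP (planeSum T)` from D1's binders `UniformFunctionalBoundPlanes`,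
  `PlaneLimits r sch φ T`, `PolyRenorm`, `PolyVolume` and ONE extra hypothesis `TwistLetters r (subseq sch φ hφ)` — the socket above fed to the LANDED
  transfer `diagRPOfPlaneLimits_of_swapPairingLiminf` (lead-27398-D1, p827255);
* `stub_diagRPOfPlaneLimits_of_twistLetters`: the same with D1's EXACT binder list (`HasWeakCouplingLimit` and `RPSpectral` carried, unused) followed
  by the one letter hypothesis — i.e. «D1 ⟸ TwistLetters on the witness sub-scheme», the shape the successor lead (O4 WORD 20 (4)) composes with
  the hands' model files.

WHAT REMAINS FOR D1 VIA DOOR B (honest): a `DiagonalSliceModel r (subseq sch φ hφ)` carrying R1 and R2 — i.e. the construction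
`wilsonDiagonalModel` (hand-10604-wilsonDiagModel-1, ⟨10604⟩ helpers p825205–p827014…, NOT landed as a model yet) AND the two physics letters on it:
R1 `OddTwistGap` (the `U`-odd sector of the odd root of the diagonal transfer operator is spectrally suppressed by `e^{−γ a_k}` — 45°-universality
content, expected from `RPSpectral` + thermodynamics but NOT proved) and R2 `DiagLukewarm` (lukewarm trace bound).  Neither is proved here or
anywhere; D1, the crux ⟨27398⟩ and its heart S6i are OPEN; nothing here bears on the summit; the Yang–Mills mass gap is NOT proved here or anywhere
in the tree.  No definition, no instance, no notation, `autoImplicit false`.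

References: Osterwalder–Seiler, Ann. Phys. 110 (1978) §2–3; Fröhlich–Israel–Lieb–Simon, Comm. Math. Phys. 62 (1978) Thm 2.1; Seiler, LNP 159
(1982) Ch. 2.
-/

set_option autoImplicit false

noncomputable section

open scoped SchwartzMap
open MeasureTheory Filter Topology
open Literature.MathematicalPhysics.QuantumLattice Literature.MathematicalPhysics.AQFT
  Literature.MathematicalPhysics.QuantumFieldTheory
open Summit.QuantumFields.YangMills.Cruxes.HypercubicLimit.CouplingResponse
open Summit.QuantumFields.YangMills.Cruxes.DiagonalMirrorRPR.ParityBridgeColdTraces (E4 DiagonalFrameRP)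
open Summit.QuantumFields.YangMills.Cruxes.DiagonalMirrorRPR.SignTwistedDiagonalTrace

namespace Summit.QuantumFields.YangMills.Theorems.WeakCouplingHypercubicLimit.TraceNormColdPressure

section DoorB

variable {G : Type} [Group G] [TopologicalSpace G] [IsTopologicalGroup G] [CompactSpace G]
  [MeasurableSpace G] [BorelSpace G] (r : LatticeRep G) (sch : SpeciesScheme (YMSpecies G)) (φ : ℕ → ℕ) (hφ : StrictMono φ)

/-- **The socket along `φ` from the door-B letters on the sub-scheme**: `TwistLetters r (subseq sch φ hφ)` and D1's binders `PolyRenorm`,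
`UniformFunctionalBoundPlanes`, `PolyVolume` (on the SCHEME) give `OddTorusSwapPairingLiminf r (subseq sch φ hφ)` — `core_of` at the sub-scheme, its
`Growth` letter discharged by `growth_subseq_of_polyRenorm_of_ufbPlanes` (κ3). -/
theorem oddTorusSwapPairingLiminf_subseq_of_twistLetters (hL : TwistLetters r (subseq sch φ hφ)) (hc : PolyRenorm r sch)
    (hU : UniformFunctionalBoundPlanes r sch) (hV : PolyVolume sch) : OddTorusSwapPairingLiminf r (subseq sch φ hφ) := by
  obtain ⟨𝔪, hR1, hR2⟩ := hL
  exact core_of 𝔪 hR1 hR2 (growth_subseq_of_polyRenorm_of_ufbPlanes r sch hc hU hV φ hφ)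

/-- The same with the letters on the SCHEME (restricted along `φ` by `TwistLetters.subseq`, i.e. `DiagonalSliceModel.restrict φ hφ`). -/
theorem oddTorusSwapPairingLiminf_subseq_of_twistLetters_scheme (hL : TwistLetters r sch) (hc : PolyRenorm r sch)
    (hU : UniformFunctionalBoundPlanes r sch) (hV : PolyVolume sch) : OddTorusSwapPairingLiminf r (subseq sch φ hφ) :=
  oddTorusSwapPairingLiminf_subseq_of_twistLetters r sch φ hφ (hL.subseq r sch φ hφ) hc hU hV

/-- The socket on the SCHEME itself from the letters on the scheme (`core_of` + `growth_of_polyRenorm_of_ufbPlanes`; the aside crux ⟨10604⟩'s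
door-B shape below its `stub_closure`). -/
theorem oddTorusSwapPairingLiminf_of_twistLetters (hL : TwistLetters r sch) (hc : PolyRenorm r sch)
    (hU : UniformFunctionalBoundPlanes r sch) (hV : PolyVolume sch) : OddTorusSwapPairingLiminf r sch := by
  obtain ⟨𝔪, hR1, hR2⟩ := hL
  exact core_of 𝔪 hR1 hR2 (growth_of_polyRenorm_of_ufbPlanes r sch hc hU hV)

/-- **D1 ⟸ the door-B letters on the witness sub-scheme.**  For the D1 witness `(subseq sch φ hφ, planeSum T)`: `UniformFunctionalBoundPlanes`,
`PlaneLimits r sch φ T`, `PolyRenorm`, `PolyVolume` and `TwistLetters r (subseq sch φ hφ)` give reflection positivity of `planeSum T` in every diagonal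
frame — the socket (`oddTorusSwapPairingLiminf_subseq_of_twistLetters`) fed to the landed transfer `diagRPOfPlaneLimits_of_swapPairingLiminf`
(p827255; its verbatim socket binder IS `OddTorusSwapPairingLiminf r (subseq sch φ hφ)`, `oddTorusSwapPairingLiminf_iff`). -/
theorem diagRPOfPlaneLimits_of_twistLetters
    (T : (n : ℕ) → (Fin n → Plane) → (𝓢((Fin n → EuclideanSpace ℝ (Fin 4)), ℂ) →L[ℂ] ℂ))
    (hV : PolyVolume sch) (hc : PolyRenorm r sch) (hU : UniformFunctionalBoundPlanes r sch) (hPL : PlaneLimits r sch φ T)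
    (hL : TwistLetters r (subseq sch φ hφ)) : DiagonalFrameRP (planeSum T) :=
  diagRPOfPlaneLimits_of_swapPairingLiminf G r sch φ hφ T hU hPL
    ((oddTorusSwapPairingLiminf_iff r _).1 (oddTorusSwapPairingLiminf_subseq_of_twistLetters r sch φ hφ hL hc hU hV))

end DoorB

/-- **`stub_diagRPOfPlaneLimits` modulo the door-B letters** — D1's EXACT binder list (skeleton `7bf38c709623ad77` :1618; `HasWeakCouplingLimit` and
`RPSpectral` are carried but not used by door B's glue) followed by ONE hypothesis, `TwistLetters r (subseq sch φ hφ)` (R1 + R2 on some two-sector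
spectral model of the witness sub-scheme — to be supplied by `wilsonDiagonalModel` and its letters), implies D1's conclusion.  This is the door-B
composition of O4 WORD 20 (4) below the model letters; it does NOT close D1. -/
theorem stub_diagRPOfPlaneLimits_of_twistLetters :
    ∀ (G : Type) [Group G] [TopologicalSpace G] [IsTopologicalGroup G] [CompactSpace G]
      [MeasurableSpace G] [BorelSpace G] (r : LatticeRep G) (sch : SpeciesScheme (YMSpecies G))
      (φ : ℕ → ℕ) (hφ : StrictMono φ)
      (T : (n : ℕ) → (Fin n → Plane) → (𝓢((Fin n → EuclideanSpace ℝ (Fin 4)), ℂ) →L[ℂ] ℂ)),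
      sch.HasWeakCouplingLimit → PolyVolume sch → PolyRenorm r sch → UniformFunctionalBoundPlanes r sch →
        (∃ Δ C : ℝ, 0 < Δ ∧ RPSpectral r sch Δ C) → PlaneLimits r sch φ T →
        TwistLetters r (subseq sch φ hφ) → DiagonalFrameRP (planeSum T) := by
  intro G _ _ _ _ _ _ r sch φ hφ T _ hV hc hU _ hPL hL
  exact diagRPOfPlaneLimits_of_twistLetters r sch φ hφ T hV hc hU hPL hL

/-- **D1′ (the ρ1 reshape's lattice stub `stub_oddTorusSwapPairingLiminf`, critic idea-crit-9 g12 bytes `Sketch.rho1.lean`; director-ym O4 WORD 20 (2))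
modulo the door-B letters** — D1′'s EXACT binder list (= D1's: `HasWeakCouplingLimit`, `PolyVolume`, `PolyRenorm`, `UniformFunctionalBoundPlanes`,
`RPSpectral`, `PlaneLimits`; the first and the last two are carried, unused by door B's glue) followed by ONE hypothesis `TwistLetters r (subseq sch φ hφ)`
implies D1′'s conclusion `OddTorusSwapPairingLiminf r (subseq sch φ hφ)` BY NAME (`core_of` at the sub-scheme with `Growth` discharged from
`PolyRenorm ∧ UniformFunctionalBoundPlanes ∧ PolyVolume`, κ3).  The successor lead's door-B composition for D1′; it does NOT close D1′ (R1/R2 on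
`wilsonDiagonalModel` are unproved). -/
theorem stub_oddTorusSwapPairingLiminf_of_twistLetters :
    ∀ (G : Type) [Group G] [TopologicalSpace G] [IsTopologicalGroup G] [CompactSpace G]
      [MeasurableSpace G] [BorelSpace G] (r : LatticeRep G) (sch : SpeciesScheme (YMSpecies G))
      (φ : ℕ → ℕ) (hφ : StrictMono φ)
      (T : (n : ℕ) → (Fin n → Plane) → (𝓢((Fin n → EuclideanSpace ℝ (Fin 4)), ℂ) →L[ℂ] ℂ)),
      sch.HasWeakCouplingLimit → PolyVolume sch → PolyRenorm r sch → UniformFunctionalBoundPlanes r sch →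
        (∃ Δ C : ℝ, 0 < Δ ∧ RPSpectral r sch Δ C) → PlaneLimits r sch φ T →
        TwistLetters r (subseq sch φ hφ) → OddTorusSwapPairingLiminf r (subseq sch φ hφ) := by
  intro G _ _ _ _ _ _ r sch φ hφ T _ hV hc hU _ _ hL
  exact oddTorusSwapPairingLiminf_subseq_of_twistLetters r sch φ hφ hL hc hU hV

end Summit.QuantumFields.YangMills.Theorems.WeakCouplingHypercubicLimit.TraceNormColdPressure

end
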